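import Mathlib

/-!
# Co-volume packing for ordered escape ladders (support file)

Item `stmt-MatrixMultiplication-14308` (`FourierTwoFamiliesModP.PrimeTwoFamilies`, CKSU 2005 Conj. 4.7
with prime cyclic hosts), registered stub `ladder_card_mul_sqrt_le` (the packing bound behind the apex
`(θ, γ) = (1/2, 1)` of the cyclic ladder form `LadderLift.primeTwoFamilies_iff_cyclicLadder` of the crux).

An ORDERED ESCAPE LADDER in an additive group `G` is a family of `r` classes `(X c, Y c)`,
`c : Fin r`, such that for classes `p < q` every lower cross difference `y' - x'` (`x' ∈ X p`,
`y' ∈ Y q`) differs from every diagonal difference `y - x` (`x ∈ X c`, `y ∈ Y c`, any class `c`) —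
hypothesis `hL` below.  Directness of the classes is NOT assumed anywhere in this file.

Contents (bottom-up; everything but the last theorem is stated for an arbitrary additive group `G`,
so it applies verbatim to the tori `(ZMod M)^L` of `LadderLift.isLadder_lexProd` as well as to `ZMod m`):

* `disjoint_X_of_lt`, `disjoint_Y_of_lt`: for `p < q`, `X p ∩ X q = ∅` as soon as `Y q ≠ ∅`, and
  `Y p ∩ Y q = ∅` as soon as `X p ≠ ∅` (take `c = q`, resp. `c = p`, in `hL` and the coincidence
  `y - x = y - x`);
* `pairwiseDisjoint_X`, `pairwiseDisjoint_Y`, `sum_card_X_le_card`, `sum_card_Y_le_card`: over any set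
  `S` of classes whose partner sides are non-empty the `X`-sides (resp. `Y`-sides) are pairwise
  disjoint, hence `∑_{c ∈ S} |X c| ≤ |G|` (resp. `∑_{c ∈ S} |Y c| ≤ |G|`);
* `sum_sqrt_card_mul_card_le_card` (HETEROGENEOUS PACKING): `∑_c √(|X c| · |Y c|) ≤ |G|` for every
  ordered escape ladder in a finite additive group — no non-emptiness and no uniform co-volume is
  assumed (classes with an empty side contribute `0`; on the others both families are pairwise
  disjoint and AM–GM `2 √(a b) ≤ a + b` applies class by class);
* `ladder_card_mul_sqrt_le` — the registered stub, verbatim: in `ZMod m`, uniform co-volume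
  `|X c| · |Y c| ≥ P` gives `r · √P ≤ m`, as the specialisation `G = ZMod m`,
  `√P ≤ √(|X c| · |Y c|)` of the heterogeneous bound.

Relation to the tree.  `LadderLift.ladder_card_mul_sqrt_le` (`…PrimeTwoFamiliesLadderPacking.lean`)
proves the same stub directly for uniform `P` in `ZMod m` with private helpers; this file makes the
disjointness lemmas public, removes the uniformity / positivity assumptions from the packing statement
and works in any finite additive group, which is the form in which class-by-class counting is used on
the kill side (ladders whose classes have different co-volumes).
-/

-- single-conjunct summit: the mandated namespace repeats `MatrixMultiplication` (summit = sub-problem).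
set_option linter.dupNamespace false

namespace Summit.MatrixMultiplication.MatrixMultiplication.Theorems.PrimeTwoFamilies.LadderCovolumePacking

open Finset

/-! ### Disjointness of the sides -/

/-- In an ordered escape ladder, for classes `p < q` the `X`-sides `X p`, `X q` are disjoint as soon
as `Y q` is non-empty: a common point `x₀ ∈ X p ∩ X q` and any `y₀ ∈ Y q` give the diagonal difference
`y₀ - x₀` of class `q` equal to the cross difference `y₀ - x₀` between `X p` and `Y q`. -/
theorem disjoint_X_of_lt {G : Type*} [AddGroup G] {r : ℕ} (X Y : Fin r → Finset G)
    (hL : ∀ c p q : Fin r, p < q → ∀ x ∈ X c, ∀ y ∈ Y c, ∀ x' ∈ X p, ∀ y' ∈ Y q, y - x ≠ y' - x')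
    {p q : Fin r} (hpq : p < q) (hYq : (Y q).Nonempty) : Disjoint (X p) (X q) := by
  rw [Finset.disjoint_left]
  intro x hxp hxq
  obtain ⟨y, hy⟩ := hYq
  exact hL q p q hpq x hxq y hy x hxp y hy rfl

/-- In an ordered escape ladder, for classes `p < q` the `Y`-sides `Y p`, `Y q` are disjoint as soon
as `X p` is non-empty: a common point `y₀ ∈ Y p ∩ Y q` and any `x₀ ∈ X p` give the diagonal difference
`y₀ - x₀` of class `p` equal to the cross difference `y₀ - x₀` between `X p` and `Y q`. -/
theorem disjoint_Y_of_lt {G : Type*} [AddGroup G] {r : ℕ} (X Y : Fin r → Finset G)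
    (hL : ∀ c p q : Fin r, p < q → ∀ x ∈ X c, ∀ y ∈ Y c, ∀ x' ∈ X p, ∀ y' ∈ Y q, y - x ≠ y' - x')
    {p q : Fin r} (hpq : p < q) (hXp : (X p).Nonempty) : Disjoint (Y p) (Y q) := by
  rw [Finset.disjoint_left]
  intro y hyp hyq
  obtain ⟨x, hx⟩ := hXp
  exact hL p p q hpq x hx y hyp x hx y hyq rfl

/-- On a set `S` of classes with non-empty `Y`-sides, the `X`-sides of an ordered escape ladder are
pairwise disjoint. -/
theorem pairwiseDisjoint_X {G : Type*} [AddGroup G] {r : ℕ} (X Y : Fin r → Finset G)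
    (hL : ∀ c p q : Fin r, p < q → ∀ x ∈ X c, ∀ y ∈ Y c, ∀ x' ∈ X p, ∀ y' ∈ Y q, y - x ≠ y' - x')
    (S : Finset (Fin r)) (hY : ∀ c ∈ S, (Y c).Nonempty) :
    (S : Set (Fin r)).PairwiseDisjoint X := by
  intro p hp q hq hpq
  rcases lt_or_gt_of_ne hpq with h | h
  · exact disjoint_X_of_lt X Y hL h (hY q hq)
  · exact (disjoint_X_of_lt X Y hL h (hY p hp)).symm

/-- On a set `S` of classes with non-empty `X`-sides, the `Y`-sides of an ordered escape ladder are
pairwise disjoint. -/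
theorem pairwiseDisjoint_Y {G : Type*} [AddGroup G] {r : ℕ} (X Y : Fin r → Finset G)
    (hL : ∀ c p q : Fin r, p < q → ∀ x ∈ X c, ∀ y ∈ Y c, ∀ x' ∈ X p, ∀ y' ∈ Y q, y - x ≠ y' - x')
    (S : Finset (Fin r)) (hX : ∀ c ∈ S, (X c).Nonempty) :
    (S : Set (Fin r)).PairwiseDisjoint Y := by
  intro p hp q hq hpq
  rcases lt_or_gt_of_ne hpq with h | h
  · exact disjoint_Y_of_lt X Y hL h (hX p hp)
  · exact (disjoint_Y_of_lt X Y hL h (hX q hq)).symm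

/-! ### Counting -/

/-- A family of subsets of a finite type that is pairwise disjoint on `S` has total size at most the
size of the type. -/
theorem sum_card_le_card_of_pairwiseDisjoint {G : Type*} [Fintype G] {r : ℕ} (Z : Fin r → Finset G)
    (S : Finset (Fin r)) (hZ : (S : Set (Fin r)).PairwiseDisjoint Z) :
    ∑ c ∈ S, (Z c).card ≤ Fintype.card G := by
  classical
  rw [← Finset.card_biUnion hZ]
  exact Finset.card_le_univ _

/-- `∑_{c ∈ S} |X c| ≤ |G|` over any set `S` of classes of an ordered escape ladder whose `Y`-sides are
non-empty. -/
theorem sum_card_X_le_card {G : Type*} [AddGroup G] [Fintype G] {r : ℕ} (X Y : Fin r → Finset G)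
    (hL : ∀ c p q : Fin r, p < q → ∀ x ∈ X c, ∀ y ∈ Y c, ∀ x' ∈ X p, ∀ y' ∈ Y q, y - x ≠ y' - x')
    (S : Finset (Fin r)) (hY : ∀ c ∈ S, (Y c).Nonempty) :
    ∑ c ∈ S, (X c).card ≤ Fintype.card G :=
  sum_card_le_card_of_pairwiseDisjoint X S (pairwiseDisjoint_X X Y hL S hY)

/-- `∑_{c ∈ S} |Y c| ≤ |G|` over any set `S` of classes of an ordered escape ladder whose `X`-sides are
non-empty. -/
theorem sum_card_Y_le_card {G : Type*} [AddGroup G] [Fintype G] {r : ℕ} (X Y : Fin r → Finset G)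
    (hL : ∀ c p q : Fin r, p < q → ∀ x ∈ X c, ∀ y ∈ Y c, ∀ x' ∈ X p, ∀ y' ∈ Y q, y - x ≠ y' - x')
    (S : Finset (Fin r)) (hX : ∀ c ∈ S, (X c).Nonempty) :
    ∑ c ∈ S, (Y c).card ≤ Fintype.card G :=
  sum_card_le_card_of_pairwiseDisjoint Y S (pairwiseDisjoint_Y X Y hL S hX)

/-- AM–GM in the form `2 √(a b) ≤ a + b` for `a, b ≥ 0`. -/
theorem two_mul_sqrt_mul_le_add {a b : ℝ} (ha : 0 ≤ a) (hb : 0 ≤ b) :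
    2 * Real.sqrt (a * b) ≤ a + b := by
  rw [Real.sqrt_mul ha]
  nlinarith [sq_nonneg (Real.sqrt a - Real.sqrt b), Real.sq_sqrt ha, Real.sq_sqrt hb,
    Real.sqrt_nonneg a, Real.sqrt_nonneg b]

/-- **Heterogeneous packing bound for ordered escape ladders.**  For every ordered escape ladder
`(X c, Y c)_{c < r}` in a finite additive group `G` (hypothesis `hL`; no directness, non-emptiness or
uniformity assumed), `∑_c √(|X c| · |Y c|) ≤ |G|`.  Classes with an empty side contribute `0`; on the
set `S` of the other classes the `X`-sides are pairwise disjoint and so are the `Y`-sides, whence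
`∑_{c ∈ S} (|X c| + |Y c|) ≤ 2 |G|`, and `2 √(|X c| |Y c|) ≤ |X c| + |Y c|` class by class. -/
theorem sum_sqrt_card_mul_card_le_card {G : Type*} [AddGroup G] [Fintype G] {r : ℕ}
    (X Y : Fin r → Finset G)
    (hL : ∀ c p q : Fin r, p < q → ∀ x ∈ X c, ∀ y ∈ Y c, ∀ x' ∈ X p, ∀ y' ∈ Y q, y - x ≠ y' - x') :
    ∑ c, Real.sqrt (((X c).card : ℝ) * (Y c).card) ≤ Fintype.card G := by
  classical
  -- the classes with both sides non-empty
  set S : Finset (Fin r) := Finset.univ.filter fun c => (X c).Nonempty ∧ (Y c).Nonempty with hS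
  have hmem : ∀ c, c ∈ S ↔ (X c).Nonempty ∧ (Y c).Nonempty := fun c => by simp [hS]
  -- the other classes contribute nothing
  have hzero : ∀ c, c ∉ S → Real.sqrt (((X c).card : ℝ) * (Y c).card) = 0 := by
    intro c hc
    rw [hmem, not_and_or, Finset.not_nonempty_iff_eq_empty, Finset.not_nonempty_iff_eq_empty] at hc
    rcases hc with h | h <;> simp [h]
  have hsplit : ∑ c ∈ S, Real.sqrt (((X c).card : ℝ) * (Y c).card) =
      ∑ c, Real.sqrt (((X c).card : ℝ) * (Y c).card) :=
    Finset.sum_subset (Finset.subset_univ S) fun c _ hc => hzero c hc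
  -- both families are pairwise disjoint on `S`
  have hX : ((∑ c ∈ S, (X c).card : ℕ) : ℝ) ≤ Fintype.card G := by
    exact_mod_cast sum_card_X_le_card X Y hL S fun c hc => ((hmem c).1 hc).2
  have hY : ((∑ c ∈ S, (Y c).card : ℕ) : ℝ) ≤ Fintype.card G := by
    exact_mod_cast sum_card_Y_le_card X Y hL S fun c hc => ((hmem c).1 hc).1
  -- AM–GM class by class
  have hcls : ∀ c ∈ S,
      2 * Real.sqrt (((X c).card : ℝ) * (Y c).card) ≤ ((X c).card : ℝ) + (Y c).card :=
    fun c _ => two_mul_sqrt_mul_le_add (Nat.cast_nonneg _) (Nat.cast_nonneg _)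
  have hsum := Finset.sum_le_sum hcls
  rw [← Finset.mul_sum, Finset.sum_add_distrib] at hsum
  push_cast at hX hY
  rw [← hsplit]
  linarith

/-! ### The registered stub -/

/-- **Packing bound for ordered escape ladders** (registered stub `ladder_card_mul_sqrt_le` of item
`stmt-MatrixMultiplication-14308`, verbatim).  If `(X c, Y c)_{c < r}` is an ordered escape ladder in
`ZMod m` (hypothesis `hL`) all of whose classes have co-volume `|X c| · |Y c| ≥ P` (`P > 0`), then
`r · √P ≤ m`.  Proof: `r · √P = ∑_c √P ≤ ∑_c √(|X c| · |Y c|) ≤ |ZMod m| = m` by the heterogeneous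
packing bound `sum_sqrt_card_mul_card_le_card`.  (The positivity hypothesis `hP0` is part of the
registered signature; the argument does not need it.) -/
theorem ladder_card_mul_sqrt_le {m : ℕ} [NeZero m] {r : ℕ} (X Y : Fin r → Finset (ZMod m))
    (hL : ∀ c p q : Fin r, p < q → ∀ x ∈ X c, ∀ y ∈ Y c, ∀ x' ∈ X p, ∀ y' ∈ Y q, y - x ≠ y' - x')
    {P : ℝ} (_hP0 : 0 < P) (hP : ∀ c : Fin r, P ≤ (((X c).card * (Y c).card : ℕ) : ℝ)) :
    (r : ℝ) * Real.sqrt P ≤ (m : ℝ) := by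
  have hcls : ∀ c ∈ (univ : Finset (Fin r)),
      Real.sqrt P ≤ Real.sqrt (((X c).card : ℝ) * (Y c).card) := by
    intro c _
    apply Real.sqrt_le_sqrt
    exact_mod_cast hP c
  have h := Finset.sum_le_sum hcls
  rw [Finset.sum_const, Finset.card_univ, Fintype.card_fin, nsmul_eq_mul] at h
  calc (r : ℝ) * Real.sqrt P ≤ ∑ c, Real.sqrt (((X c).card : ℝ) * (Y c).card) := h
    _ ≤ Fintype.card (ZMod m) := sum_sqrt_card_mul_card_le_card X Y hL
    _ = m := by rw [ZMod.card]

end Summit.MatrixMultiplication.MatrixMultiplication.Theorems.PrimeTwoFamilies.LadderCovolumePacking
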